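import Summits.HodgeConjecture.HodgeConjecture.Theorems.BoundaryReadoutHCOverNumberFieldsTransfer
import Literature.AlgebraicGeometry.HodgeTheory.HodgeConjectureQbarVoisin
import Literature.AlgebraicGeometry.HodgeTheory.ComplexConjugationHolds
import HarnessLib

/-!
# Route `BoundaryReadout` — crux `AbsoluteReduction` (stmt-HodgeConjecture-15945):
# the crux from Voisin's Proposition 1.2 (CONDITIONAL closing file)

`BoundaryReadout.AbsoluteReduction` reads

  `HCOverNumberFields → ∀ ⦃n X⦄, IsSmoothProjective n X →
     Nonempty (HodgeModel n X) ∧ ∀ p (c : H²ᵖ(X(ℂ); ℂ)), IsAbsoluteHodgeClass n X p c → c ∈ algebraicClasses X p`.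

Its first conjunct is the PROVED tree fact `nonempty_hodgeModel_holds` (Serre GAGA + de Rham + the
Hodge decomposition of a projective manifold); its second conjunct is, verbatim on the tree's
carriers, the conclusion of Voisin's Proposition 1.2 (absolute reading) — *"Assume the Hodge
conjecture is known for varieties defined over `ℚ̄` … Then the Hodge conjecture is true for absolute
Hodge classes"* — whose hypothesis "HC for every `X₀ ⊗_{ℚ̄,σ} ℂ`" (`PeriodDeficiency.HodgeConjectureQbar`)
is equivalent to the route's `HCOverNumberFields` by the landed transfer
`hcOverNumberFields_iff_hodgeConjectureQbar` (number-field descent of smooth projective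
`ℚ̄`-schemes, EGA IV₃ 8.8.2, and rigidity of `ℚ̄ →+* ℂ` on a number field).

This file records that position, sorry-free:

* `absoluteReduction_iff` — the crux is EQUIVALENT to its cycle clause
  `HCOverNumberFields → (absolute Hodge ⇒ algebraic)` (conjunct 1 is bookkeeping);
* `absoluteReduction_of_voisin2007` — **the crux from the Literature named fact**
  `voisin2007_hodgeConjecture_absolute_of_qbar` (Voisin 2007 Prop. 1.2, UNPROVED in the tree: its
  proof needs spreading out over `ℚ̄`, the `ℚ̄`-definability of absolute classes at `ℚ̄`-generic
  points — Deligne 1982 Prop. 2.9 / Charles–Schnell Cor. 11.3.16 — and Deligne's global invariant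
  cycle theorem). This is a CONDITIONAL result (the gate records `conditional-result`); the item
  closes when the named fact is discharged (`theorem voisin2007_hodgeConjecture_absolute_of_qbar_holds`),
  or when the registered line `Cruxes/AbsoluteReduction/Lines/generic_flatness.lean` closes its
  load-bearing stub S2 (`stub_typeStableOfAbsoluteAtQbarGeneric`, the same theorem in family form);
* `not_hodgeConjecture_of_not_absoluteReduction` — HC-safety (refuter rattack-15945-0, landed here
  in contrapositive form): a refutation of the crux refutes the summit statement;
* `absoluteReduction_of_envelope_of_pullbackAlgebraic` — items only: the crux from the sibling
  route's cruxes `QbarEnvelope.Envelope` (stmt-1069) and `PullbackAlgebraic` (stmt-1071), pure logic.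

## References

* C. Voisin, *Hodge loci and absolute Hodge classes*, Compositio Math. 143 (2007) 945–958
  (arXiv:math/0605766), Prop. 1.2, Rem. 1.4, §3. [Voisin2007HodgeLoci]
* F. Charles, C. Schnell, *Notes on absolute Hodge classes* (2014), Thm. 11.3.15, Cor. 11.3.16,
  Thm. 11.3.19. [CharlesSchnell2014Notes]
* P. Deligne, *Hodge cycles on abelian varieties*, LNM 900 (1982), Prop. 2.9. [Deligne1982HodgeCycles]
-/

-- every declaration of this problem lives in `Summit.HodgeConjecture.HodgeConjecture.…`
-- (single-problem summit: Problem = Summit), which `linter.dupNamespace` flags; set so that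
-- stand-alone elaboration is warning-free.
set_option linter.dupNamespace false

noncomputable section

namespace Summit.HodgeConjecture.HodgeConjecture.Theorems

open CategoryTheory AlgebraicGeometry
open Literature.AlgebraicGeometry Literature.AlgebraicGeometry.Motives
open Literature.AlgebraicGeometry.HodgeTheory
open Summit.HodgeConjecture.HodgeConjecture.Theses

/-- **The crux is its cycle clause.** `AbsoluteReduction` is equivalent to
"`HCOverNumberFields` ⇒ every absolute Hodge class on a smooth projective complex variety is
algebraic": the Hodge-model conjunct is the proved tree fact `nonempty_hodgeModel_holds`.
[cite: Voisin2007HodgeLoci, Prop. 1.2] -/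
theorem absoluteReduction_iff :
    BoundaryReadout.AbsoluteReduction ↔
      (BoundaryReadout.HCOverNumberFields →
        ∀ ⦃n : ℕ⦄ ⦃X : SchemeOver ℂ⦄, IsSmoothProjective n X →
          ∀ (p : ℕ) (c : complexBetti X (2 * p)), IsAbsoluteHodgeClass n X p c →
            c ∈ algebraicClasses X p) := by
  unfold BoundaryReadout.AbsoluteReduction
  exact ⟨fun h hQ n X hX ↦ (h hQ hX).2, fun h hQ n X hX ↦ ⟨nonempty_hodgeModel_holds hX, h hQ hX⟩⟩

/-- **The crux from Voisin's Proposition 1.2 (CONDITIONAL on the Literature named fact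
`voisin2007_hodgeConjecture_absolute_of_qbar`).** Given `HCOverNumberFields`, the transfer
`hodgeConjectureQbar_of_hcOverNumberFields` yields the Hodge conjecture for every `X₀ ⊗_{ℚ̄,σ} ℂ`,
which is the hypothesis of Voisin's proposition in the routes' shape
(`hodgeConjecture_absolute_of_hodgeConjectureFor_qbar`); its conclusion is the cycle clause, and the
Hodge-model conjunct is `nonempty_hodgeModel_holds`. The theorem is conditional: the named fact is
not yet discharged in the tree. [cite: Voisin2007HodgeLoci, Prop. 1.2 and Rem. 1.4] -/
theorem absoluteReduction_of_voisin2007 (hV : voisin2007_hodgeConjecture_absolute_of_qbar) :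
    BoundaryReadout.AbsoluteReduction := by
  rw [absoluteReduction_iff]
  intro hQ n X hX p c hc
  exact hodgeConjecture_absolute_of_hodgeConjectureFor_qbar hV
    (hodgeConjectureQbar_of_hcOverNumberFields hQ) hX hc

/-- **HC-safety of the crux** (contrapositive form): a refutation of `AbsoluteReduction` refutes
the audited summit statement `HodgeConjecture` — under HC every absolute Hodge class, being a
rational `(p,p)` class (`IsAbsoluteHodgeClass.isRationalClass` / `.isOfHodgeType`), is algebraic,
and the Hodge-model conjunct is the first conjunct of `HodgeConjectureFor`. So the crux admits no
counterexample short of `¬ HodgeConjecture`. [cite: Voisin2007HodgeLoci, Def. 1.1] -/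
theorem not_hodgeConjecture_of_not_absoluteReduction (h : ¬ BoundaryReadout.AbsoluteReduction) :
    ¬ _root_.HodgeConjecture := by
  intro hHC
  refine h ?_
  unfold BoundaryReadout.AbsoluteReduction
  intro _ n X hX
  exact ⟨(hHC hX).1, fun p c hc ↦ (hHC hX).2 p c hc.isRationalClass hc.isOfHodgeType⟩

/-- **The crux from the sibling route's `ℚ̄`-envelope (items only, pure logic).** If every
rational `(p,p)` class is a pull-back `ι^* c'` of a rational `(p,p)` class on a smooth projective
`W` definable over a number field (`QbarEnvelope.Envelope`, stmt-HodgeConjecture-1069) and pull-back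
preserves algebraic classes (`BoundaryReadout.PullbackAlgebraic`, stmt-HodgeConjecture-1071), then
`AbsoluteReduction` holds: an absolute Hodge class is a rational `(p,p)` class, its envelope class
`c'` is algebraic by `HCOverNumberFields` applied to `W`, and `c = ι^* c'` is algebraic by
pull-back. So the crux closes for free if stmt-1069 and stmt-1071 land (recorded lattice fact of the
strategy census). [cite: Voisin2007HodgeLoci, Prop. 1.2 and Prop. 1.7]
[cite: CharlesSchnell2014Notes, Thm. 11.3.19] -/
theorem absoluteReduction_of_envelope_of_pullbackAlgebraic (hE : QbarEnvelope.Envelope)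
    (hP : BoundaryReadout.PullbackAlgebraic) : BoundaryReadout.AbsoluteReduction := by
  rw [absoluteReduction_iff]
  intro hQ n X hX p c hc
  obtain ⟨m, W, ι, c', hW, hK, hc', hh', hmap⟩ := hE hX p c hc.isRationalClass hc.isOfHodgeType
  rw [← hmap]
  exact hP hX hW ι p c' ((hQ hW hK).2 p c' hc' hh')

end Summit.HodgeConjecture.HodgeConjecture.Theorems

end
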